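import Summits.BirchSwinnertonDyer.BirchSwinnertonDyer.Theorems.ManinLocalTwoThreeEtaQuotientsFourteen
import Literature.NumberTheory.EllipticCurves.ModularCurveSturmProofs
import HarnessLib

/-!
# Level 14: the weight-4 identity `G² = 2304A + 7488F + 18432C` in `M₄(Γ₀(14))` — the `q`-limit through `o(q⁹)` and Sturm

Cell bsd-f2-manin, route `ManinLocalTwoThree` (cruxes C2 `ManinOddAtFour` stmt-22967 / C3 `ManinPrimeToThreeAtNine` stmt-22968),
prover seat p3 gen 25; sequel to `…EtaQuotientsFourteen` (the players `𝓔 = x − 1 = η₂η₇⁷/(η₁η₁₄⁷)`, `A = φ₁₄²𝓔`, `F = φ₁₄²`,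
`C = φ₁₄²/𝓔`, `G = −E₂(τ) + 2E₂(2τ) + 49E₂(7τ) − 98E₂(14τ)` on `X₀(14) = 14a1`).

* §1 (L)₁₄: `(G² − 2304A − 7488F − 18432C)/q⁹ → 0` at `i∞` — ten `q`-coefficients, by the tree's `QRemainder` calculus on the
  Euler-function monomials (cleared by the unit `E₇⁵E₁₄⁵`; every power and product reduced modulo `X¹⁰` with an explicit quotient witness, seat script `work/l14/gen_limit2.py`);
* §2 Sturm in `M₄(Γ₀(14))` (`μ = 24`, `⌊4·24/12⌋ = 8 < 9`, tree `coe_eq_zero_of_isBigO_exp'`) ⟹ **`G² = 2304A + 7488F + 18432C`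
  on `ℍ`** (`G_sq_eq`), i.e. `G²𝓔 = 576φ₁₄²(4𝓔² + 13𝓔 + 32)` — the Weierstrass equation of `14a1` along the modular
  parametrisation, differentiated (`(2y + x + 1)² = 4x³ + x² + 18x − 23 = 𝓔(4𝓔² + 13𝓔 + 32)`, `𝓔′ = (πi/12)G𝓔`).

HONEST FRAMING: unconditional `q`-series analysis plus Sturm; nothing here proves C2, C3, Manin's conjecture or BSD; items 22967/22968
stay OPEN.  No definition, no named fact, no sorry. [cite: Zagier2008, §2.3] [cite: DiamondShurman2005, Thm. 3.5.1]
[cite: CremonaAlgorithms1997, §2.10 and Table 1 (14a1)]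
-/

set_option autoImplicit false
-- lint-debt: the directory name repeats the summit name (sibling precedent `ManinLocalTwoThreeEtaLimitsOneFortyFour.lean`)
set_option linter.dupNamespace false

noncomputable section

open Complex Filter Topology Set Asymptotics Polynomial EisensteinSeries
open UpperHalfPlane hiding I
open scoped Real Topology Manifold MatrixGroups ModularForm
open ModularForm CongruenceSubgroup
open Literature.NumberTheory.ModularForms
open Literature.NumberTheory.EllipticCurves Literature.NumberTheory.EllipticCurves.ModularForms

namespace Summit.BirchSwinnertonDyer.BirchSwinnertonDyer.Theorems.ManinLocalTwoThree.EtaIdentityFourteen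

open QRemainder EulerRemainders EtaLogDerivativeForms EtaQuotientsFourteen

/-! ## §1 (L)₁₄: `G² − 2304A − 7488F − 18432C = o(q⁹)` -/

/-- **(L)₁₄: `(G² − 2304A − 7488F − 18432C)/q⁹ → 0` at `i∞`** (cleared by `E₇⁵E₁₄⁵`). [cite: Zagier2008, §2.3] -/
theorem tendsto_L :
    Tendsto (fun τ : ℍ ↦ ((-E2 (sixMulPt 1 τ) + 2 * E2 (sixMulPt 2 τ) + 49 * E2 (sixMulPt 7 τ) - 98 * E2 (sixMulPt 14 τ)) ^ 2
      - 2304 * etaQuotient 14 (expFn [(1, 1), (2, 3), (7, 9), (14, -5)]) τ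
      - 7488 * etaQuotient 14 (expFn [(1, 2), (2, 2), (7, 2), (14, 2)]) τ
      - 18432 * etaQuotient 14 (expFn [(1, 3), (2, 1), (7, -5), (14, 9)]) τ)
      / Function.Periodic.qParam 1 (τ : ℂ) ^ 9) atImInfty (𝓝 0) := by
  have hE1 := EulerRemaindersForty.tendsto_eulerFn_one_nine
  have hE2 := EulerRemaindersFortyEight.tendsto_eulerFn_two_nine
  have hEp := tendsto_eulerFn_seven_nine
  have hEpp := tendsto_eulerFn (δ := 14) (m := 9) (by norm_num)
  have hG := QRemainder.sub (QRemainder.sub (QRemainder.add (QRemainder.const_mul 2 tendsto_E2_two_nine)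
    (QRemainder.const_mul 49 tendsto_E2_seven_nine)) (QRemainder.const_mul 98 tendsto_E2_fourteen_nine)) tendsto_E2_one_nine
  have hG2 := QRemainder.pow hG 2
  have hG2r := QRemainder.reduce (2304 - 2304 * X - 1728 * X ^ 2 - 8064 * X ^ 3 + 2880 * X ^ 4 - 8064 * X ^ 5 + 8064 * X ^ 6 + 110592 * X ^ 7 - 16704 * X ^ 8 - 50688 * X ^ 9) (-147456 - 213120 * X ^ 2 - 167040 * X ^ 3 + 1062720 * X ^ 4 + 12672 * X ^ 5 - 613440 * X ^ 6 + 14976 * X ^ 7 + 97344 * X ^ 8)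
    (by simp only [map_ofNat]; ring) hG2
  have hE2_3 := QRemainder.pow hE2 3
  have hE2_3r := QRemainder.reduce (1 - 3 * X ^ 2 + 5 * X ^ 6) (-3 - X ^ 2)
    (by ring) hE2_3
  have hm1 := QRemainder.mul hE1 hE2_3r
  have hm1r := QRemainder.reduce (1 - X - 4 * X ^ 2 + 3 * X ^ 3 + 3 * X ^ 4 + X ^ 5 + 5 * X ^ 6 - 7 * X ^ 7 - 5 * X ^ 8 - 3 * X ^ 9) (5 * X + 5 * X ^ 3)
    (by ring) hm1
  have hEp_14 := QRemainder.pow hEp 14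
  have hEp_14r := QRemainder.reduce (1 - 14 * X ^ 7) (91 * X ^ 4 - 364 * X ^ 11 + 1001 * X ^ 18 - 2002 * X ^ 25 + 3003 * X ^ 32 - 3432 * X ^ 39 + 3003 * X ^ 46 - 2002 * X ^ 53 + 1001 * X ^ 60 - 364 * X ^ 67 + 91 * X ^ 74 - 14 * X ^ 81 + X ^ 88)
    (by ring) hEp_14
  have hm2 := QRemainder.mul hm1r hEp_14r
  have hm2r := QRemainder.reduce (1 - X - 4 * X ^ 2 + 3 * X ^ 3 + 3 * X ^ 4 + X ^ 5 + 5 * X ^ 6 - 21 * X ^ 7 + 9 * X ^ 8 + 53 * X ^ 9) (-42 - 42 * X - 14 * X ^ 2 - 70 * X ^ 3 + 98 * X ^ 4 + 70 * X ^ 5 + 42 * X ^ 6)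
    (by ring) hm2
  have hE1_2 := QRemainder.pow hE1 2
  have hE1_2r := QRemainder.reduce (1 - 2 * X - X ^ 2 + 2 * X ^ 3 + X ^ 4 + 2 * X ^ 5 - 2 * X ^ 6 - 2 * X ^ 8 - 2 * X ^ 9) (1 + 2 * X ^ 2 + X ^ 4)
    (by ring) hE1_2
  have hE2_2 := QRemainder.pow hE2 2
  have hm3 := QRemainder.mul hE1_2r hE2_2
  have hm3r := QRemainder.reduce (1 - 2 * X - 3 * X ^ 2 + 6 * X ^ 3 + 2 * X ^ 4 - X ^ 6 - 10 * X ^ 7 - 2 * X ^ 9) (7 + 10 * X - X ^ 2 + 4 * X ^ 3 - 6 * X ^ 4 - 4 * X ^ 5 - 2 * X ^ 6 - 2 * X ^ 7)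
    (by ring) hm3
  have hEp_7 := QRemainder.pow hEp 7
  have hEp_7r := QRemainder.reduce (1 - 7 * X ^ 7) (21 * X ^ 4 - 35 * X ^ 11 + 35 * X ^ 18 - 21 * X ^ 25 + 7 * X ^ 32 - X ^ 39)
    (by ring) hEp_7
  have hm4 := QRemainder.mul hm3r hEp_7r
  have hm4r := QRemainder.reduce (1 - 2 * X - 3 * X ^ 2 + 6 * X ^ 3 + 2 * X ^ 4 - X ^ 6 - 17 * X ^ 7 + 14 * X ^ 8 + 19 * X ^ 9) (-42 - 14 * X + 7 * X ^ 3 + 70 * X ^ 4 + 14 * X ^ 6)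
    (by ring) hm4
  have hEpp_7 := QRemainder.pow hEpp 7
  have hm5 := QRemainder.mul hm4r hEpp_7
  have hq6 := QRemainder.qParam_pow_mul 2 hm5
  have hq6r := QRemainder.reduce (X ^ 2 - 2 * X ^ 3 - 3 * X ^ 4 + 6 * X ^ 5 + 2 * X ^ 6 - X ^ 8 - 17 * X ^ 9) (14 + 19 * X)
    (by ring) hq6
  have hE1_3 := QRemainder.pow hE1 3
  have hE1_3r := QRemainder.reduce (1 - 3 * X + 5 * X ^ 3 - 7 * X ^ 6) (9 + 3 * X ^ 2 - 6 * X ^ 3 - 3 * X ^ 4 - 2 * X ^ 5 - 3 * X ^ 6 + 3 * X ^ 7 + 3 * X ^ 9 + X ^ 11)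
    (by ring) hE1_3
  have hm7 := QRemainder.mul hE1_3r hE2
  have hm7r := QRemainder.reduce (1 - 3 * X - X ^ 2 + 8 * X ^ 3 - X ^ 4 - 2 * X ^ 5 - 7 * X ^ 6 - 5 * X ^ 7 + 7 * X ^ 8) (7)
    (by ring) hm7
  have hEpp_14 := QRemainder.pow hEpp 14
  have hm8 := QRemainder.mul hm7r hEpp_14
  have hq9 := QRemainder.qParam_pow_mul 4 hm8
  have hq9r := QRemainder.reduce (X ^ 4 - 3 * X ^ 5 - X ^ 6 + 8 * X ^ 7 - X ^ 8 - 2 * X ^ 9) (-7 - 5 * X + 7 * X ^ 2)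
    (by ring) hq9
  have hEp_5 := QRemainder.pow hEp 5
  have hEp_5r := QRemainder.reduce (1 - 5 * X ^ 7) (10 * X ^ 4 - 10 * X ^ 11 + 5 * X ^ 18 - X ^ 25)
    (by ring) hEp_5
  have hEpp_5 := QRemainder.pow hEpp 5
  have hm10 := QRemainder.mul hEp_5r hEpp_5
  have ht1 := QRemainder.mul hG2r hm10
  have ht1r := QRemainder.reduce (2304 - 2304 * X - 1728 * X ^ 2 - 8064 * X ^ 3 + 2880 * X ^ 4 - 8064 * X ^ 5 + 8064 * X ^ 6 + 99072 * X ^ 7 - 5184 * X ^ 8 - 42048 * X ^ 9) (40320 - 14400 * X + 40320 * X ^ 2 - 40320 * X ^ 3 - 552960 * X ^ 4 + 83520 * X ^ 5 + 253440 * X ^ 6)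
    (by ring) ht1
  have hv11 := QRemainder.sub ht1r (QRemainder.const_mul 2304 hm2r)
  have hv12 := QRemainder.sub hv11 (QRemainder.const_mul 7488 hq6r)
  have hv13 := QRemainder.sub hv12 (QRemainder.const_mul 18432 hq9r)
  have hV := QRemainder.reduce 0 (0)
    (by simp only [map_ofNat]; ring) hv13
  have hlim := (QRemainder.tendsto_div_pow 9 le_rfl hV).mul
    ((((isIntUnitQExp_eulerFn (by norm_num : 0 < 7)).tendsto_one.pow 5).mul
      ((isIntUnitQExp_eulerFn (by norm_num : 0 < 14)).tendsto_one.pow 5)).inv₀ (by norm_num))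
  rw [zero_mul] at hlim
  refine hlim.congr fun τ ↦ ?_
  have hE7' := eulerFn_ne_zero (by norm_num : 0 < 7) τ
  have hE14' := eulerFn_ne_zero (by norm_num : 0 < 14) τ
  have hq := qParam_ne_zero τ
  rw [A_eq, F_eq, C_eq]
  field_simp
  ring

/-! ## §2 Sturm in `M₄(Γ₀(14))` and the identity -/

/-- `μ(Γ₀(14)) = μ(2)·μ(7) = 3·8 = 24`. [cite: DiamondShurman2005, §3.8] -/
theorem gamma0Index_fourteen : gamma0Index 14 = 24 := by
  rw [show (14 : ℕ) = 2 * 7 by norm_num, gamma0Index_mul (m := 2) (n := 7) (by norm_num), gamma0Index_prime Nat.prime_two,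
    gamma0Index_prime (by norm_num)]

/-- **Sturm's bound in `M₄(Γ₀(14))`: `T/q⁹ → 0` at `i∞` forces `T = 0`** (`⌊4·24/12⌋ = 8 < 9`). [cite: DiamondShurman2005, Thm. 3.5.1] -/
theorem modularForm_fourteen_four_eq_zero_of_tendsto (T : ModularForm (Gamma0 14) (2 + 2))
    (h : Tendsto (fun τ : ℍ ↦ T τ / Function.Periodic.qParam 1 (τ : ℂ) ^ 9) atImInfty (𝓝 0)) : (⇑T) = 0 := by
  have hcard : Nat.card (𝒮ℒ ⧸ ((Gamma0 14 : Subgroup SL(2, ℤ)) : Subgroup (GL (Fin 2) ℝ)).subgroupOf 𝒮ℒ) = 24 := by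
    rw [card_quotient_subgroupOf_eq_index]
    have h1 := index_gamma0_eq_gamma0Index_holds 14
    unfold index_gamma0_eq_gamma0Index at h1
    rw [h1, gamma0Index_fourteen]
  refine coe_eq_zero_of_isBigO_exp' T (m := 9) ?_ (by
    rw [hcard]
    simp only [Int.reduceAdd, Int.reduceMul, Int.reduceToNat, Nat.reduceDiv, Nat.cast_ofNat]
    norm_num)
  have h1 : (fun τ : ℍ ↦ T τ / Function.Periodic.qParam 1 (τ : ℂ) ^ 9) =O[atImInfty] fun _ : ℍ ↦ (1 : ℝ) := h.isBigO_one ℝ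
  have h2 : (fun τ : ℍ ↦ Function.Periodic.qParam 1 (τ : ℂ) ^ 9) =O[atImInfty] fun τ : ℍ ↦ Real.exp (-2 * π * 9 * τ.im) := by
    refine Asymptotics.IsBigO.of_bound 1 (Filter.Eventually.of_forall fun τ ↦ ?_)
    rw [norm_pow, Function.Periodic.norm_qParam, Real.norm_eq_abs, abs_of_pos (Real.exp_pos _), one_mul,
      ← Real.exp_nat_mul, UpperHalfPlane.coe_im]
    apply le_of_eq
    congr 1
    push_cast
    ring
  have h3 := h1.mul h2
  simp only [one_mul] at h3
  refine h3.congr' (Filter.Eventually.of_forall fun τ ↦ ?_) Filter.EventuallyEq.rfl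
  exact div_mul_cancel₀ _ (pow_ne_zero _ (qParam_ne_zero τ))

/-- **`G² = 2304A + 7488F + 18432C` on `ℍ`** — the identity in `M₄(Γ₀(14))` (Sturm + (L)₁₄). [cite: DiamondShurman2005, Thm. 3.5.1] -/
theorem G_sq_eq (τ : ℍ) :
    (-E2 (sixMulPt 1 τ) + 2 * E2 (sixMulPt 2 τ) + 49 * E2 (sixMulPt 7 τ) - 98 * E2 (sixMulPt 14 τ)) ^ 2
      = 2304 * etaQuotient 14 (expFn [(1, 1), (2, 3), (7, 9), (14, -5)]) τ
        + 7488 * etaQuotient 14 (expFn [(1, 2), (2, 2), (7, 2), (14, 2)]) τ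
        + 18432 * etaQuotient 14 (expFn [(1, 3), (2, 1), (7, -5), (14, 9)]) τ := by
  obtain ⟨G, hG⟩ := exists_modularForm_G
  obtain ⟨FA, hA⟩ := exists_modularForm_A
  obtain ⟨FF, hF⟩ := exists_modularForm_F
  obtain ⟨FC, hC⟩ := exists_modularForm_C
  set T : ModularForm (Gamma0 14) (2 + 2) :=
    G.mul G - ((2304 : ℂ) • FA + (7488 : ℂ) • FF + (18432 : ℂ) • FC).mcast (by norm_num) with hT
  have hTapply : ∀ σ : ℍ, T σ = (-E2 (sixMulPt 1 σ) + 2 * E2 (sixMulPt 2 σ) + 49 * E2 (sixMulPt 7 σ) - 98 * E2 (sixMulPt 14 σ)) ^ 2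
      - 2304 * etaQuotient 14 (expFn [(1, 1), (2, 3), (7, 9), (14, -5)]) σ
      - 7488 * etaQuotient 14 (expFn [(1, 2), (2, 2), (7, 2), (14, 2)]) σ
      - 18432 * etaQuotient 14 (expFn [(1, 3), (2, 1), (7, -5), (14, 9)]) σ := by
    intro σ
    simp only [hT, ModularForm.sub_apply, ModularForm.add_apply, ModularForm.coe_mul, Pi.mul_apply, ModularForm.coe_mcast,
      ModularForm.IsGLPos.smul_apply, smul_eq_mul, hG σ]
    rw [show (FA : ℍ → ℂ) σ = etaQuotient 14 (expFn [(1, 1), (2, 3), (7, 9), (14, -5)]) σ from congrFun hA σ,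
      show (FF : ℍ → ℂ) σ = etaQuotient 14 (expFn [(1, 2), (2, 2), (7, 2), (14, 2)]) σ from congrFun hF σ,
      show (FC : ℍ → ℂ) σ = etaQuotient 14 (expFn [(1, 3), (2, 1), (7, -5), (14, 9)]) σ from congrFun hC σ]
    ring
  have hT0 : (⇑T) = 0 := modularForm_fourteen_four_eq_zero_of_tendsto T (tendsto_L.congr fun σ ↦ by rw [hTapply σ])
  have e := congrFun hT0 τ
  rw [hTapply τ, Pi.zero_apply] at e
  linear_combination e

/-- **`G²𝓔 = 576φ₁₄²(4𝓔² + 13𝓔 + 32)` on `ℍ`** with `φ₁₄ = η₁η₂η₇η₁₄` (`A = φ₁₄²𝓔`, `F = φ₁₄²`, `C = φ₁₄²/𝓔` by `η`-exponent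
bookkeeping). [cite: CremonaAlgorithms1997, §2.10] -/
theorem G_sq_mul_E_eq (τ : ℍ) :
    (-E2 (sixMulPt 1 τ) + 2 * E2 (sixMulPt 2 τ) + 49 * E2 (sixMulPt 7 τ) - 98 * E2 (sixMulPt 14 τ)) ^ 2
        * etaQuotient 14 (expFn [(1, -1), (2, 1), (7, 7), (14, -7)]) τ
      = 576 * etaQuotient 14 (expFn [(1, 1), (2, 1), (7, 1), (14, 1)]) τ ^ 2
        * (4 * etaQuotient 14 (expFn [(1, -1), (2, 1), (7, 7), (14, -7)]) τ ^ 2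
          + 13 * etaQuotient 14 (expFn [(1, -1), (2, 1), (7, 7), (14, -7)]) τ + 32) := by
  have hE1 := eulerFn_ne_zero (by norm_num : 0 < 1) τ
  have hE2 := eulerFn_ne_zero (by norm_num : 0 < 2) τ
  have hE7 := eulerFn_ne_zero (by norm_num : 0 < 7) τ
  have hE14 := eulerFn_ne_zero (by norm_num : 0 < 14) τ
  have hq := qParam_ne_zero τ
  rw [G_sq_eq τ, A_eq, F_eq, C_eq, E_eq, EtaMonomialsFiftySix.phi14_eq]
  field_simp
  ring

end Summit.BirchSwinnertonDyer.BirchSwinnertonDyer.Theorems.ManinLocalTwoThree.EtaIdentityFourteen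

end
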